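import Literature.NumberTheory.EllipticCurves.ZpExtensionEisensteinDVRSettingH4AdjointProofs
import Literature.NumberTheory.GaloisCohomology.Howard2004.DualityDatumRestrictedPairingNaturalityProofs
import HarnessLib

/-!
# H.4 at the places `v ∣ p` for the curve's Eisenstein setting, VII: reduction compatibility (hB) and the projection
# formulas (Adj), (Adj′) for the RESTRICTED pairings `Fil_v W_j × Tw W_j / Fil′_j → A_{m,j}(1)` of the tower

`Proofs` file (theorems only; no definition, no named fact, no instance, no `sorry`).  Sequel of
`ZpExtensionEisensteinDVRSettingH4AdjointProofs` (the full pairings) and the generic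
`Howard2004/DualityDatumRestrictedPairingNaturalityProofs`.

In the rank-free proof of (Exact) for `F_𝔮` at `v ∣ p` (cell memo `HOME/p1/H4-EXACT-AT-P-PLAN-x10b-p1-g8.md` §1(c)–(d)) the limit
right-kernel-torsion step (x10b-p1-w8's `Tower.pow_smul_eq_zero_of_forall_pairing_eq_zero`) runs on the PAIR of towers
`X_j = H¹(K_v, Fil_v W_j)`, `Y_j = H¹(K_v, Tw W_j / Fil′_j)` with the restricted pairings `P_j` (x10b-p1-w7's
`DualityDatum.exists_restrictedPairing`, characterised by `P_j (s, [t]) = e_j (s, t)`) and needs (hB) and the projection formula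
(Adj) `incQ d (P_k (red^{(d)} w, y)) = P_{k+d} (w, up′_d y)`.  For the curve's tower `W.eisensteinTower κ hm`
(`T^{(j)} = E_K[p^{j+1}] ⊗ A_{m,j+1}(ψ)`) and ANY H.4 data `D k` over `A_{m,k+1}` with the reduction identity `he_red`, this file
supplies the module-level `e`-clauses and the instantiated identities, for ANY `Γ_{K_v}`-stable `V_j ≤ T^{(j)}`, `V′_j ≤ Tw T^{(j)}`,
any restricted pairings `P_j` with the characterising property, and any maps of the sub- and quotient representations lying over
the tower's iterated reduction `red^{(d)}` and division `F (k+1) (k+d+1)` (x10b-p1-w6's `subFamily` / `quotFamily` shapes):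

* §1 the `e`-clauses: `eisensteinTower_apply_e_transfer_redIter` (`ι_d (e_k (s, red^{(d)} t)) = e_{k+d} (F s, t)`) and
  `eisensteinTower_apply_e_redIter_transfer` (`ι_d (e_k (red^{(d)} s, t)) = e_{k+d} (s, F t)`) for any value map `ι_d` with
  `ι_d ∘ reduce = p^d ·` — from `reduce_e_redIter`, `eisensteinTwistTorsionTransfer_redIter` and bilinearity;
* §2 (hB-res) `eisensteinTower_restrictedPairing_cupProduct_red` (one reduction step, `φ := reduce`, from `he_red`),
  (Adj-res) `eisensteinTower_restrictedPairing_cupProduct_adjoint` (reduction on the sub side, division on the quotient side —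
  the `hAdj` shape of `Tower.pow_smul_eq_zero_of_forall_pairing_eq_zero` once `red^{(d)}` of the `H¹(Fil)`-tower is read as
  `H¹(g_{k+d,k})` by `Tower.redIter_eq_map`), (Adj′-res) `eisensteinTower_restrictedPairing_cupProduct_adjoint'` (mirror).

Cell `pub/bsd-print-x9` (STUB A `hfin4` at `v ∣ p`, (Exact) brick (B6) inputs).  No summit statement is proved here; BSD is not
proved by any of this.  References: [Howard2004HeegnerKolyvagin] §1.3 H.4 (arXiv:1202.6340 p. 7 L78–82), §1.6 (p. 11 L33–38),
Lemma 3.1.1, Def. 3.2.5–3.2.6; [NeukirchSchmidtWingberg2008] I §4 (1.4.2)–(1.4.6); [MilneADT2006] I Cor. 2.3.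
-/

set_option autoImplicit false

noncomputable section

open Function NumberField IsDedekindDomain Field CategoryTheory
open scoped NumberField ContRepresentation

namespace WeierstrassCurve

open Literature.NumberTheory.EllipticCurves Literature.NumberTheory.GaloisRepresentations
open Literature.NumberTheory.GaloisRepresentations.DiscreteGaloisModule
open Literature.NumberTheory.GaloisCohomology Literature.NumberTheory.GaloisCohomology.Howard2004
open Literature.NumberTheory.EllipticCurves.ZpExtension (EisensteinLevel)

variable {K : Type} [Field K] [NumberField K] (W : WeierstrassCurve ℚ) [W.IsElliptic] {p : ℕ} [hp : Fact p.Prime]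
  (κ : ZpExtension K p) {m : ℕ} (hm : 1 ≤ m) (cd : ConjugationDatum K)
  (D : letI := IwasawaAlgebra.isLocalRing_quotient_X_pow_add_C p hm
    ∀ k, DualityDatum p cd ((W.eisensteinTower κ hm).ρ k) (IwasawaAlgebra.EisensteinCoeff p m (k + 1)))
  (he_red : letI := IwasawaAlgebra.isLocalRing_quotient_X_pow_add_C p hm
    ∀ k (x y : EisensteinLevel p m (fun j ↦ geomTorsion (W.baseChange K) ((p : ℤ) ^ j)) (k + 1 + 1)),
      IwasawaAlgebra.EisensteinCoeff.reduce p m (Nat.le_succ (k + 1)) ((D (k + 1)).e x y) =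
        (D k).e ((W.eisensteinTower κ hm).red k x) ((W.eisensteinTower κ hm).red k y))

/-! ## §1 The module-level `e`-clauses along `(red^{(d)}, F (k+1) (k+d+1), ι_d)` -/

include he_red in
/-- **`ι_d (e_k (s, red^{(d)} t)) = e_{k+d} (F (k+1) (k+d+1) s, t)`** for any value map `ι_d` with `ι_d ∘ reduce = p^d ·`
(`he_red^{(d)}`, `F ∘ red^{(d)} = p^d ·`, bilinearity). [cite: Howard2004HeegnerKolyvagin, §1.6 (arXiv p. 11, L33–38) and Def. 1.1.3] -/
theorem eisensteinTower_apply_e_transfer_redIter (k d : ℕ)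
    (ι : IwasawaAlgebra.EisensteinCoeff p m (k + 1) →+ IwasawaAlgebra.EisensteinCoeff p m (k + d + 1))
    (hι : ∀ x : IwasawaAlgebra.EisensteinCoeff p m (k + d + 1),
      ι (IwasawaAlgebra.EisensteinCoeff.reduce p m (Nat.succ_le_succ (Nat.le_add_right k d)) x) = p ^ d • x)
    (s : EisensteinLevel p m (fun j ↦ geomTorsion (W.baseChange K) ((p : ℤ) ^ j)) (k + 1))
    (t : EisensteinLevel p m (fun j ↦ geomTorsion (W.baseChange K) ((p : ℤ) ^ j)) (k + d + 1)) :
    letI := IwasawaAlgebra.isLocalRing_quotient_X_pow_add_C p hm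
    ι ((D k).e s ((W.eisensteinTower κ hm).redIter k d t)) =
      (D (k + d)).e ((W.baseChange K).eisensteinTwistTorsionTransfer κ hm
          (fun j ↦ (W.baseChange K).torsionGaloisModuleReduce p j) (W.torsionGaloisModuleReduce_coe (K := K) (p := p))
          (k + 1) (k + d + 1)
          (s : IwasawaAlgebra.EisensteinCoeff.Twisted p m (k + 1) (geomTorsion (W.baseChange K) ((p : ℤ) ^ (k + 1))))) t := by
  letI := IwasawaAlgebra.isLocalRing_quotient_X_pow_add_C p hm
  obtain ⟨s', rfl⟩ := (W.eisensteinTower κ hm).redIter_surjective k d s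
  have h1 := W.reduce_e_redIter κ hm cd D he_red k d s' t
  have h2 := W.eisensteinTwistTorsionTransfer_redIter κ hm k d s'
  rw [← h1, hι]
  change _ = (D (k + d)).e ((W.baseChange K).eisensteinTwistTorsionTransfer κ hm
    (fun j ↦ (W.baseChange K).torsionGaloisModuleReduce p j) (W.torsionGaloisModuleReduce_coe (K := K) (p := p))
    (k + 1) (k + d + 1) _) t
  rw [h2, map_nsmul]
  rfl

include he_red in
/-- **`ι_d (e_k (red^{(d)} s, t)) = e_{k+d} (s, F (k+1) (k+d+1) t)`** (the mirror clause).
[cite: Howard2004HeegnerKolyvagin, §1.6 (arXiv p. 11, L33–38) and Def. 1.1.3] -/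
theorem eisensteinTower_apply_e_redIter_transfer (k d : ℕ)
    (ι : IwasawaAlgebra.EisensteinCoeff p m (k + 1) →+ IwasawaAlgebra.EisensteinCoeff p m (k + d + 1))
    (hι : ∀ x : IwasawaAlgebra.EisensteinCoeff p m (k + d + 1),
      ι (IwasawaAlgebra.EisensteinCoeff.reduce p m (Nat.succ_le_succ (Nat.le_add_right k d)) x) = p ^ d • x)
    (s : EisensteinLevel p m (fun j ↦ geomTorsion (W.baseChange K) ((p : ℤ) ^ j)) (k + d + 1))
    (t : EisensteinLevel p m (fun j ↦ geomTorsion (W.baseChange K) ((p : ℤ) ^ j)) (k + 1)) :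
    letI := IwasawaAlgebra.isLocalRing_quotient_X_pow_add_C p hm
    ι ((D k).e ((W.eisensteinTower κ hm).redIter k d s) t) =
      (D (k + d)).e s ((W.baseChange K).eisensteinTwistTorsionTransfer κ hm
          (fun j ↦ (W.baseChange K).torsionGaloisModuleReduce p j) (W.torsionGaloisModuleReduce_coe (K := K) (p := p))
          (k + 1) (k + d + 1)
          (t : IwasawaAlgebra.EisensteinCoeff.Twisted p m (k + 1) (geomTorsion (W.baseChange K) ((p : ℤ) ^ (k + 1))))) := by
  letI := IwasawaAlgebra.isLocalRing_quotient_X_pow_add_C p hm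
  obtain ⟨t', rfl⟩ := (W.eisensteinTower κ hm).redIter_surjective k d t
  have h1 := W.reduce_e_redIter κ hm cd D he_red k d s t'
  have h2 := W.eisensteinTwistTorsionTransfer_redIter κ hm k d t'
  rw [← h1, hι]
  change _ = (D (k + d)).e s ((W.baseChange K).eisensteinTwistTorsionTransfer κ hm
    (fun j ↦ (W.baseChange K).torsionGaloisModuleReduce p j) (W.torsionGaloisModuleReduce_coe (K := K) (p := p))
    (k + 1) (k + d + 1) _)
  rw [h2, LinearMap.map_smul_of_tower]

/-! ## §2 (hB-res), (Adj-res), (Adj′-res) for restricted pairings of the tower -/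

include he_red in
/-- **(hB-res) one reduction step**: for restricted pairings `P₁` at level `k+1` and `P₂` at level `k` (any stable `V`, `V′` and
the characterising property `P (s, [t]) = e (s, t)`), maps `u`, `r` of the sub- and quotient representations lying over the
tower's reduction `red_k`, and `φ := reduce`: `H²(reduce(1)) (x ∪_{P₁} y) = H¹(u) x ∪_{P₂} H¹(r) y`.
[cite: Howard2004HeegnerKolyvagin, §1.6 (arXiv p. 11, L33–38), Lemma 3.1.1 and Def. 3.2.6] [cite: NeukirchSchmidtWingberg2008, I §4 (1.4.2)] -/
theorem eisensteinTower_restrictedPairing_cupProduct_red (v : HeightOneSpectrum (𝓞 K)) [CharZero (v.adicCompletion K)] (k : ℕ)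
    {V₁ : letI := IwasawaAlgebra.isLocalRing_quotient_X_pow_add_C p hm
      Submodule ℤ (EisensteinLevel p m (fun j ↦ geomTorsion (W.baseChange K) ((p : ℤ) ^ j)) (k + 1 + 1))}
    {hV₁ : letI := IwasawaAlgebra.isLocalRing_quotient_X_pow_add_C p hm
      ∀ σ : absoluteGaloisGroup (v.adicCompletion K), V₁ ≤ V₁.comap (GaloisRep.toLocal v ((W.eisensteinTower κ hm).ρ (k + 1)) σ)}
    {V₁' : letI := IwasawaAlgebra.isLocalRing_quotient_X_pow_add_C p hm
      Submodule ℤ (EisensteinLevel p m (fun j ↦ geomTorsion (W.baseChange K) ((p : ℤ) ^ j)) (k + 1 + 1))}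
    {hV₁' : letI := IwasawaAlgebra.isLocalRing_quotient_X_pow_add_C p hm
      ∀ σ : absoluteGaloisGroup (v.adicCompletion K),
        V₁' ≤ V₁'.comap (GaloisRep.toLocal v (cd.twist ((W.eisensteinTower κ hm).ρ (k + 1))) σ)}
    {V₂ : letI := IwasawaAlgebra.isLocalRing_quotient_X_pow_add_C p hm
      Submodule ℤ (EisensteinLevel p m (fun j ↦ geomTorsion (W.baseChange K) ((p : ℤ) ^ j)) (k + 1))}
    {hV₂ : letI := IwasawaAlgebra.isLocalRing_quotient_X_pow_add_C p hm
      ∀ σ : absoluteGaloisGroup (v.adicCompletion K), V₂ ≤ V₂.comap (GaloisRep.toLocal v ((W.eisensteinTower κ hm).ρ k) σ)}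
    {V₂' : letI := IwasawaAlgebra.isLocalRing_quotient_X_pow_add_C p hm
      Submodule ℤ (EisensteinLevel p m (fun j ↦ geomTorsion (W.baseChange K) ((p : ℤ) ^ j)) (k + 1))}
    {hV₂' : letI := IwasawaAlgebra.isLocalRing_quotient_X_pow_add_C p hm
      ∀ σ : absoluteGaloisGroup (v.adicCompletion K),
        V₂' ≤ V₂'.comap (GaloisRep.toLocal v (cd.twist ((W.eisensteinTower κ hm).ρ k)) σ)}
    (P₁ : letI := IwasawaAlgebra.isLocalRing_quotient_X_pow_add_C p hm
      ContPairing ((GaloisRep.toLocal v ((W.eisensteinTower κ hm).ρ (k + 1))).subrepresentation V₁ hV₁).toTopRep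
        ((GaloisRep.toLocal v (cd.twist ((W.eisensteinTower κ hm).ρ (k + 1)))).quotient V₁' hV₁').toTopRep
        (GaloisRep.toLocal v (D (k + 1)).twistOne).toTopRep)
    (hP₁ : ∀ (s : V₁) (t), P₁.toLin s (Submodule.Quotient.mk t) = (D (k + 1)).e (s : _) t)
    (P₂ : letI := IwasawaAlgebra.isLocalRing_quotient_X_pow_add_C p hm
      ContPairing ((GaloisRep.toLocal v ((W.eisensteinTower κ hm).ρ k)).subrepresentation V₂ hV₂).toTopRep
        ((GaloisRep.toLocal v (cd.twist ((W.eisensteinTower κ hm).ρ k))).quotient V₂' hV₂').toTopRep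
        (GaloisRep.toLocal v (D k).twistOne).toTopRep)
    (hP₂ : ∀ (s : V₂) (t), P₂.toLin s (Submodule.Quotient.mk t) = (D k).e (s : _) t)
    (u : letI := IwasawaAlgebra.isLocalRing_quotient_X_pow_add_C p hm
      ((GaloisRep.toLocal v ((W.eisensteinTower κ hm).ρ (k + 1))).subrepresentation V₁ hV₁).toContRepresentation →ⁱL
        ((GaloisRep.toLocal v ((W.eisensteinTower κ hm).ρ k)).subrepresentation V₂ hV₂).toContRepresentation)
    (hu : letI := IwasawaAlgebra.isLocalRing_quotient_X_pow_add_C p hm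
      ∀ s : V₁, ((u s : V₂) : _) = (W.eisensteinTower κ hm).red k (s : _))
    (r : letI := IwasawaAlgebra.isLocalRing_quotient_X_pow_add_C p hm
      ((GaloisRep.toLocal v (cd.twist ((W.eisensteinTower κ hm).ρ (k + 1)))).quotient V₁' hV₁').toContRepresentation →ⁱL
        ((GaloisRep.toLocal v (cd.twist ((W.eisensteinTower κ hm).ρ k))).quotient V₂' hV₂').toContRepresentation)
    (hr : letI := IwasawaAlgebra.isLocalRing_quotient_X_pow_add_C p hm
      ∀ t, r (Submodule.Quotient.mk t) = Submodule.Quotient.mk ((W.eisensteinTower κ hm).red k t))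
    (x : letI := IwasawaAlgebra.isLocalRing_quotient_X_pow_add_C p hm
      galoisCohomology ((GaloisRep.toLocal v ((W.eisensteinTower κ hm).ρ (k + 1))).subrepresentation V₁ hV₁) 1)
    (y : letI := IwasawaAlgebra.isLocalRing_quotient_X_pow_add_C p hm
      galoisCohomology ((GaloisRep.toLocal v (cd.twist ((W.eisensteinTower κ hm).ρ (k + 1)))).quotient V₁' hV₁') 1) :
    letI := IwasawaAlgebra.isLocalRing_quotient_X_pow_add_C p hm
    ContinuousRep.cohomologyMap (GaloisRep.toLocal v (D (k + 1)).twistOne) (GaloisRep.toLocal v (D k).twistOne)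
        (IwasawaAlgebra.EisensteinCoeff.reduce p m (Nat.le_succ (k + 1))).toAddMonoidHom continuous_of_discreteTopology
        (fun _ z => W.reduce_twistOne κ hm cd D k _ z) 2 (P₁.cupProduct x y) =
      P₂.cupProduct (galoisCohomology.map u 1 x) (galoisCohomology.map r 1 y) := by
  letI := IwasawaAlgebra.isLocalRing_quotient_X_pow_add_C p hm
  exact (D (k + 1)).restrictedPairing_cupProduct_map (D k) v P₁ hP₁ P₂ hP₂ _ (fun g z => W.reduce_twistOne κ hm cd D k g z)
    u ((W.eisensteinTower κ hm).red k).toAddMonoidHom hu r ((W.eisensteinTower κ hm).red k).toAddMonoidHom hr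
    (fun s t => he_red k s t) x y

include he_red in
/-- **(Adj-res)**: for restricted pairings `P₁` at level `k` and `P₂` at level `k+d` (any stable `V`, `V′`, characterising
property), `u : Fil_{k+d} → Fil_k` over the iterated reduction `red^{(d)}`, `r : Tw T^{(k)}/V′ → Tw T^{(k+d)}/V′` over the
division `F (k+1) (k+d+1)`, and ANY value map `ι_d` with `ι_d ∘ reduce = p^d ·`:
`H²(ι_d(1)) (H¹(u) w ∪_{P₁} y) = w ∪_{P₂} H¹(r) y` — the `hAdj` shape of `Tower.pow_smul_eq_zero_of_forall_pairing_eq_zero` for the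
pair `(H¹(K_v, Fil), H¹(K_v, Tw/V′))`. [cite: Howard2004HeegnerKolyvagin, §1.3 H.4 (arXiv p. 7, L78–82), §1.6 (p. 11 L33–38), Def. 3.2.6]
[cite: NeukirchSchmidtWingberg2008, I §4 (1.4.2)–(1.4.6)] -/
theorem eisensteinTower_restrictedPairing_cupProduct_adjoint (v : HeightOneSpectrum (𝓞 K)) [CharZero (v.adicCompletion K)]
    (k d : ℕ)
    (ι : IwasawaAlgebra.EisensteinCoeff p m (k + 1) →+ IwasawaAlgebra.EisensteinCoeff p m (k + d + 1))
    (hι : ∀ x : IwasawaAlgebra.EisensteinCoeff p m (k + d + 1),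
      ι (IwasawaAlgebra.EisensteinCoeff.reduce p m (Nat.succ_le_succ (Nat.le_add_right k d)) x) = p ^ d • x)
    {V₁ : letI := IwasawaAlgebra.isLocalRing_quotient_X_pow_add_C p hm
      Submodule ℤ (EisensteinLevel p m (fun j ↦ geomTorsion (W.baseChange K) ((p : ℤ) ^ j)) (k + 1))}
    {hV₁ : letI := IwasawaAlgebra.isLocalRing_quotient_X_pow_add_C p hm
      ∀ σ : absoluteGaloisGroup (v.adicCompletion K), V₁ ≤ V₁.comap (GaloisRep.toLocal v ((W.eisensteinTower κ hm).ρ (k)) σ)}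
    {V₁' : letI := IwasawaAlgebra.isLocalRing_quotient_X_pow_add_C p hm
      Submodule ℤ (EisensteinLevel p m (fun j ↦ geomTorsion (W.baseChange K) ((p : ℤ) ^ j)) (k + 1))}
    {hV₁' : letI := IwasawaAlgebra.isLocalRing_quotient_X_pow_add_C p hm
      ∀ σ : absoluteGaloisGroup (v.adicCompletion K),
        V₁' ≤ V₁'.comap (GaloisRep.toLocal v (cd.twist ((W.eisensteinTower κ hm).ρ (k))) σ)}
    {V₂ : letI := IwasawaAlgebra.isLocalRing_quotient_X_pow_add_C p hm
      Submodule ℤ (EisensteinLevel p m (fun j ↦ geomTorsion (W.baseChange K) ((p : ℤ) ^ j)) (k + d + 1))}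
    {hV₂ : letI := IwasawaAlgebra.isLocalRing_quotient_X_pow_add_C p hm
      ∀ σ : absoluteGaloisGroup (v.adicCompletion K), V₂ ≤ V₂.comap (GaloisRep.toLocal v ((W.eisensteinTower κ hm).ρ (k + d)) σ)}
    {V₂' : letI := IwasawaAlgebra.isLocalRing_quotient_X_pow_add_C p hm
      Submodule ℤ (EisensteinLevel p m (fun j ↦ geomTorsion (W.baseChange K) ((p : ℤ) ^ j)) (k + d + 1))}
    {hV₂' : letI := IwasawaAlgebra.isLocalRing_quotient_X_pow_add_C p hm
      ∀ σ : absoluteGaloisGroup (v.adicCompletion K),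
        V₂' ≤ V₂'.comap (GaloisRep.toLocal v (cd.twist ((W.eisensteinTower κ hm).ρ (k + d))) σ)}
    (P₁ : letI := IwasawaAlgebra.isLocalRing_quotient_X_pow_add_C p hm
      ContPairing ((GaloisRep.toLocal v ((W.eisensteinTower κ hm).ρ (k))).subrepresentation V₁ hV₁).toTopRep
        ((GaloisRep.toLocal v (cd.twist ((W.eisensteinTower κ hm).ρ (k)))).quotient V₁' hV₁').toTopRep
        (GaloisRep.toLocal v (D (k)).twistOne).toTopRep)
    (hP₁ : ∀ (s : V₁) (t), P₁.toLin s (Submodule.Quotient.mk t) = (D (k)).e (s : _) t)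
    (P₂ : letI := IwasawaAlgebra.isLocalRing_quotient_X_pow_add_C p hm
      ContPairing ((GaloisRep.toLocal v ((W.eisensteinTower κ hm).ρ (k + d))).subrepresentation V₂ hV₂).toTopRep
        ((GaloisRep.toLocal v (cd.twist ((W.eisensteinTower κ hm).ρ (k + d)))).quotient V₂' hV₂').toTopRep
        (GaloisRep.toLocal v (D (k + d)).twistOne).toTopRep)
    (hP₂ : ∀ (s : V₂) (t), P₂.toLin s (Submodule.Quotient.mk t) = (D (k + d)).e (s : _) t)
    (u : letI := IwasawaAlgebra.isLocalRing_quotient_X_pow_add_C p hm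
      ((GaloisRep.toLocal v ((W.eisensteinTower κ hm).ρ (k + d))).subrepresentation V₂ hV₂).toContRepresentation →ⁱL
        ((GaloisRep.toLocal v ((W.eisensteinTower κ hm).ρ k)).subrepresentation V₁ hV₁).toContRepresentation)
    (hu : letI := IwasawaAlgebra.isLocalRing_quotient_X_pow_add_C p hm
      ∀ s : V₂, ((u s : V₁) : _) = (W.eisensteinTower κ hm).redIter k d (s : _))
    (r : letI := IwasawaAlgebra.isLocalRing_quotient_X_pow_add_C p hm
      ((GaloisRep.toLocal v (cd.twist ((W.eisensteinTower κ hm).ρ k))).quotient V₁' hV₁').toContRepresentation →ⁱL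
        ((GaloisRep.toLocal v (cd.twist ((W.eisensteinTower κ hm).ρ (k + d)))).quotient V₂' hV₂').toContRepresentation)
    (hr : letI := IwasawaAlgebra.isLocalRing_quotient_X_pow_add_C p hm
      ∀ t, r (Submodule.Quotient.mk t) = Submodule.Quotient.mk
        ((W.baseChange K).eisensteinTwistTorsionTransfer κ hm
          (fun j ↦ (W.baseChange K).torsionGaloisModuleReduce p j) (W.torsionGaloisModuleReduce_coe (K := K) (p := p))
          (k + 1) (k + d + 1)
          (t : IwasawaAlgebra.EisensteinCoeff.Twisted p m (k + 1) (geomTorsion (W.baseChange K) ((p : ℤ) ^ (k + 1))))))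
    (w : letI := IwasawaAlgebra.isLocalRing_quotient_X_pow_add_C p hm
      galoisCohomology ((GaloisRep.toLocal v ((W.eisensteinTower κ hm).ρ (k + d))).subrepresentation V₂ hV₂) 1)
    (y : letI := IwasawaAlgebra.isLocalRing_quotient_X_pow_add_C p hm
      galoisCohomology ((GaloisRep.toLocal v (cd.twist ((W.eisensteinTower κ hm).ρ k))).quotient V₁' hV₁') 1) :
    letI := IwasawaAlgebra.isLocalRing_quotient_X_pow_add_C p hm
    ContinuousRep.cohomologyMap (GaloisRep.toLocal v (D k).twistOne) (GaloisRep.toLocal v (D (k + d)).twistOne) ι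
        continuous_of_discreteTopology
        (fun _ z => (D k).twistOne_apply_of_apply_reduce (D (k + d)) _ ι (p ^ d) hι _ z) 2
        (P₁.cupProduct (galoisCohomology.map u 1 w) y) =
      P₂.cupProduct w (galoisCohomology.map r 1 y) := by
  letI := IwasawaAlgebra.isLocalRing_quotient_X_pow_add_C p hm
  exact (D k).restrictedPairing_cupProduct_map_adjoint (D (k + d)) v P₁ hP₁ P₂ hP₂ ι
    (fun g z => (D k).twistOne_apply_of_apply_reduce (D (k + d)) _ ι (p ^ d) hι g z)
    u ((W.eisensteinTower κ hm).redIter k d).toAddMonoidHom hu r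
    (((W.baseChange K).eisensteinTwistTorsionTransfer κ hm
          (fun j ↦ (W.baseChange K).torsionGaloisModuleReduce p j) (W.torsionGaloisModuleReduce_coe (K := K) (p := p))
          (k + 1) (k + d + 1)).toContinuousLinearMap.toLinearMap.toAddMonoidHom) hr
    (fun s' t' => W.eisensteinTower_apply_e_redIter_transfer κ hm cd D he_red k d ι hι s' t') w y

include he_red in
/-- **(Adj′-res)** (mirror variance): `u : Fil_k → Fil_{k+d}` over the division `F (k+1) (k+d+1)`, `r : Tw T^{(k+d)}/V′ → Tw T^{(k)}/V′`
over the iterated reduction `red^{(d)}`, ANY `ι_d` with `ι_d ∘ reduce = p^d ·`: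
`H²(ι_d(1)) (x ∪_{P₁} H¹(r) w) = H¹(u) x ∪_{P₂} w`. [cite: Howard2004HeegnerKolyvagin, §1.3 H.4 (arXiv p. 7, L78–82), §1.6 (p. 11 L33–38), Def. 3.2.6]
[cite: NeukirchSchmidtWingberg2008, I §4 (1.4.2)–(1.4.6)] -/
theorem eisensteinTower_restrictedPairing_cupProduct_adjoint' (v : HeightOneSpectrum (𝓞 K)) [CharZero (v.adicCompletion K)]
    (k d : ℕ)
    (ι : IwasawaAlgebra.EisensteinCoeff p m (k + 1) →+ IwasawaAlgebra.EisensteinCoeff p m (k + d + 1))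
    (hι : ∀ x : IwasawaAlgebra.EisensteinCoeff p m (k + d + 1),
      ι (IwasawaAlgebra.EisensteinCoeff.reduce p m (Nat.succ_le_succ (Nat.le_add_right k d)) x) = p ^ d • x)
    {V₁ : letI := IwasawaAlgebra.isLocalRing_quotient_X_pow_add_C p hm
      Submodule ℤ (EisensteinLevel p m (fun j ↦ geomTorsion (W.baseChange K) ((p : ℤ) ^ j)) (k + 1))}
    {hV₁ : letI := IwasawaAlgebra.isLocalRing_quotient_X_pow_add_C p hm
      ∀ σ : absoluteGaloisGroup (v.adicCompletion K), V₁ ≤ V₁.comap (GaloisRep.toLocal v ((W.eisensteinTower κ hm).ρ (k)) σ)}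
    {V₁' : letI := IwasawaAlgebra.isLocalRing_quotient_X_pow_add_C p hm
      Submodule ℤ (EisensteinLevel p m (fun j ↦ geomTorsion (W.baseChange K) ((p : ℤ) ^ j)) (k + 1))}
    {hV₁' : letI := IwasawaAlgebra.isLocalRing_quotient_X_pow_add_C p hm
      ∀ σ : absoluteGaloisGroup (v.adicCompletion K),
        V₁' ≤ V₁'.comap (GaloisRep.toLocal v (cd.twist ((W.eisensteinTower κ hm).ρ (k))) σ)}
    {V₂ : letI := IwasawaAlgebra.isLocalRing_quotient_X_pow_add_C p hm
      Submodule ℤ (EisensteinLevel p m (fun j ↦ geomTorsion (W.baseChange K) ((p : ℤ) ^ j)) (k + d + 1))}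
    {hV₂ : letI := IwasawaAlgebra.isLocalRing_quotient_X_pow_add_C p hm
      ∀ σ : absoluteGaloisGroup (v.adicCompletion K), V₂ ≤ V₂.comap (GaloisRep.toLocal v ((W.eisensteinTower κ hm).ρ (k + d)) σ)}
    {V₂' : letI := IwasawaAlgebra.isLocalRing_quotient_X_pow_add_C p hm
      Submodule ℤ (EisensteinLevel p m (fun j ↦ geomTorsion (W.baseChange K) ((p : ℤ) ^ j)) (k + d + 1))}
    {hV₂' : letI := IwasawaAlgebra.isLocalRing_quotient_X_pow_add_C p hm
      ∀ σ : absoluteGaloisGroup (v.adicCompletion K),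
        V₂' ≤ V₂'.comap (GaloisRep.toLocal v (cd.twist ((W.eisensteinTower κ hm).ρ (k + d))) σ)}
    (P₁ : letI := IwasawaAlgebra.isLocalRing_quotient_X_pow_add_C p hm
      ContPairing ((GaloisRep.toLocal v ((W.eisensteinTower κ hm).ρ (k))).subrepresentation V₁ hV₁).toTopRep
        ((GaloisRep.toLocal v (cd.twist ((W.eisensteinTower κ hm).ρ (k)))).quotient V₁' hV₁').toTopRep
        (GaloisRep.toLocal v (D (k)).twistOne).toTopRep)
    (hP₁ : ∀ (s : V₁) (t), P₁.toLin s (Submodule.Quotient.mk t) = (D (k)).e (s : _) t)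
    (P₂ : letI := IwasawaAlgebra.isLocalRing_quotient_X_pow_add_C p hm
      ContPairing ((GaloisRep.toLocal v ((W.eisensteinTower κ hm).ρ (k + d))).subrepresentation V₂ hV₂).toTopRep
        ((GaloisRep.toLocal v (cd.twist ((W.eisensteinTower κ hm).ρ (k + d)))).quotient V₂' hV₂').toTopRep
        (GaloisRep.toLocal v (D (k + d)).twistOne).toTopRep)
    (hP₂ : ∀ (s : V₂) (t), P₂.toLin s (Submodule.Quotient.mk t) = (D (k + d)).e (s : _) t)
    (u : letI := IwasawaAlgebra.isLocalRing_quotient_X_pow_add_C p hm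
      ((GaloisRep.toLocal v ((W.eisensteinTower κ hm).ρ k)).subrepresentation V₁ hV₁).toContRepresentation →ⁱL
        ((GaloisRep.toLocal v ((W.eisensteinTower κ hm).ρ (k + d))).subrepresentation V₂ hV₂).toContRepresentation)
    (hu : letI := IwasawaAlgebra.isLocalRing_quotient_X_pow_add_C p hm
      ∀ s : V₁, ((u s : V₂) : EisensteinLevel p m (fun j ↦ geomTorsion (W.baseChange K) ((p : ℤ) ^ j)) (k + d + 1)) =
        (W.baseChange K).eisensteinTwistTorsionTransfer κ hm
          (fun j ↦ (W.baseChange K).torsionGaloisModuleReduce p j) (W.torsionGaloisModuleReduce_coe (K := K) (p := p))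
          (k + 1) (k + d + 1)
          ((s : EisensteinLevel p m (fun j ↦ geomTorsion (W.baseChange K) ((p : ℤ) ^ j)) (k + 1)) :
            IwasawaAlgebra.EisensteinCoeff.Twisted p m (k + 1) (geomTorsion (W.baseChange K) ((p : ℤ) ^ (k + 1)))))
    (r : letI := IwasawaAlgebra.isLocalRing_quotient_X_pow_add_C p hm
      ((GaloisRep.toLocal v (cd.twist ((W.eisensteinTower κ hm).ρ (k + d)))).quotient V₂' hV₂').toContRepresentation →ⁱL
        ((GaloisRep.toLocal v (cd.twist ((W.eisensteinTower κ hm).ρ k))).quotient V₁' hV₁').toContRepresentation)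
    (hr : letI := IwasawaAlgebra.isLocalRing_quotient_X_pow_add_C p hm
      ∀ t, r (Submodule.Quotient.mk t) = Submodule.Quotient.mk ((W.eisensteinTower κ hm).redIter k d t))
    (x : letI := IwasawaAlgebra.isLocalRing_quotient_X_pow_add_C p hm
      galoisCohomology ((GaloisRep.toLocal v ((W.eisensteinTower κ hm).ρ k)).subrepresentation V₁ hV₁) 1)
    (w : letI := IwasawaAlgebra.isLocalRing_quotient_X_pow_add_C p hm
      galoisCohomology ((GaloisRep.toLocal v (cd.twist ((W.eisensteinTower κ hm).ρ (k + d)))).quotient V₂' hV₂') 1) :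
    letI := IwasawaAlgebra.isLocalRing_quotient_X_pow_add_C p hm
    ContinuousRep.cohomologyMap (GaloisRep.toLocal v (D k).twistOne) (GaloisRep.toLocal v (D (k + d)).twistOne) ι
        continuous_of_discreteTopology
        (fun _ z => (D k).twistOne_apply_of_apply_reduce (D (k + d)) _ ι (p ^ d) hι _ z) 2
        (P₁.cupProduct x (galoisCohomology.map r 1 w)) =
      P₂.cupProduct (galoisCohomology.map u 1 x) w := by
  letI := IwasawaAlgebra.isLocalRing_quotient_X_pow_add_C p hm
  exact (D k).restrictedPairing_cupProduct_map_adjoint' (D (k + d)) v P₁ hP₁ P₂ hP₂ ι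
    (fun g z => (D k).twistOne_apply_of_apply_reduce (D (k + d)) _ ι (p ^ d) hι g z)
    u (((W.baseChange K).eisensteinTwistTorsionTransfer κ hm
          (fun j ↦ (W.baseChange K).torsionGaloisModuleReduce p j) (W.torsionGaloisModuleReduce_coe (K := K) (p := p))
          (k + 1) (k + d + 1)).toContinuousLinearMap.toLinearMap.toAddMonoidHom) hu r
    ((W.eisensteinTower κ hm).redIter k d).toAddMonoidHom hr
    (fun s' t' => W.eisensteinTower_apply_e_transfer_redIter κ hm cd D he_red k d ι hι s' t') x w

end WeierstrassCurve

end
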